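import Summits.Schanuel.Schanuel.Theorems.DiophantineDichotomyDefs

/-!
# The pair-measure stub of line `bounded-index-core` contains `e ⊥ π`
(crux stmt-Schanuel-6118 `DiophantineDichotomy.EPiSimultaneousType`; `--supports`, strength certificate)

`stub_pairMeasure` of `Cruxes/EPiSimultaneousType/Lines/bounded-index-core.lean` asks for a decoupled
codimension-one measure of algebraic independence of `(π, e)` with SOME total-degree exponent `μ < 3`
(`CodimOneMeasure 2 ![π, e] μ K C`, vocabulary of `Theorems/DiophantineDichotomyDefs.lean`). This file
kernel-checks the lead's reason for handing that stub back as crux-sized (`promote-stub`):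

* `algebraicIndependent_of_codimOneMeasure`: ANY decoupled codimension-one measure at `ω ∈ ℂᵐ` (any
  exponents, any constant) makes the coordinates of `ω` algebraically independent over `ℚ` — the
  measure forbids `P(ω) = 0` for every non-zero integer `P`, i.e. algebraic independence over `ℤ`,
  which is the same as over `ℚ = Frac ℤ` (`Algebra.IsAlgebraic.algebraicIndependent_iff`).
* `expOnePiAlgebraicIndependent_of_pairMeasure` (REGISTERED on the item): the statement of
  `stub_pairMeasure`, verbatim, implies the tree's OPEN conjecture
  `Literature.NumberTheory.Transcendental.ExpOnePiAlgebraicIndependent` (`AlgebraicIndependent ℚ ![e, π]`,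
  `@[conjecture]`, PeriodsWave0) — so the stub is at least as strong as the algebraic independence of
  `e` and `π`, which is also the strongest known CONSEQUENCE of the crux itself (route support `EPiRace`
  + Laurent–Roy's level-one approximation property, Disproof §3 `epiRace_kernel`). No measure of
  algebraic independence of `(π, e)` of any shape is in print (grounder g18-9; disprover v2 §6).

Nothing is asserted; both theorems are implications. No `def`.
-/

set_option linter.dupNamespace false

noncomputable section

namespace Summit.Schanuel.Schanuel.Theorems

open Summit.Schanuel.Schanuel.Cruxes.KhovanskiiApproxType.LwSmallHeight

namespace EPiSimultaneousType.BoundedIndexCore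

/-- **A decoupled codimension-one measure forces algebraic independence.** If
`CodimOneMeasure m ω μ K C` holds (any `μ, K`; `C > 0` is part of the definition), then the
coordinates of `ω` are algebraically independent over `ℚ`: for a non-zero `P ∈ ℤ[X₁,…,X_m]` the
measure gives `|P(ω)| ≥ exp(−…) > 0`, so `aeval ω` is injective on `ℤ`-polynomials, and algebraic
independence over `ℤ` and over `ℚ` coincide (`ℚ` is algebraic over `ℤ` as its fraction field).
[folklore] -/
theorem algebraicIndependent_of_codimOneMeasure {m : ℕ} {ω : Fin m → ℂ} {μ K C : ℝ}
    (h : CodimOneMeasure m ω μ K C) : AlgebraicIndependent ℚ ω := by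
  have hZ : AlgebraicIndependent ℤ ω := by
    rw [algebraicIndependent_iff]
    intro P hP
    by_contra hP0
    have hle := h.2 P hP0
    rw [hP, norm_zero] at hle
    exact absurd hle (not_le.mpr (Real.exp_pos _))
  haveI : Algebra.IsAlgebraic ℤ ℚ := IsLocalization.isAlgebraic ℚ (nonZeroDivisors ℤ)
  exact (Algebra.IsAlgebraic.algebraicIndependent_iff ℤ ℚ).1 hZ

/-- **`stub_pairMeasure` contains `e ⊥ π`.** The registered stub statement of line
`bounded-index-core` — a decoupled codimension-one measure for `(π, e)` with some exponent `μ < 3` —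
implies the open conjecture `ExpOnePiAlgebraicIndependent` (`AlgebraicIndependent ℚ ![e, π]` over `ℝ`):
algebraic independence of `![(π : ℂ), (e : ℂ)]` by `algebraicIndependent_of_codimOneMeasure`, then the
index swap `![1, 0]` and the transfer along the injective `ℚ`-algebra map `ℝ → ℂ`. Hence the stub is
crux-sized: it is at least the algebraic independence of `e` and `π`, WITH a measure. [folklore] -/
theorem expOnePiAlgebraicIndependent_of_pairMeasure :
    (∃ μ K C : ℝ, 0 ≤ μ ∧ μ < 3 ∧ 0 ≤ K ∧ CodimOneMeasure 2 ![(Real.pi : ℂ), (Real.exp 1 : ℂ)] μ K C) →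
    Literature.NumberTheory.Transcendental.ExpOnePiAlgebraicIndependent := by
  rintro ⟨μ, K, C, -, -, -, hC⟩
  have hθ : AlgebraicIndependent ℚ ![(Real.pi : ℂ), (Real.exp 1 : ℂ)] :=
    algebraicIndependent_of_codimOneMeasure hC
  -- swap the indices
  have hswap : AlgebraicIndependent ℚ (![(Real.pi : ℂ), (Real.exp 1 : ℂ)] ∘ ![(1 : Fin 2), 0]) :=
    hθ.comp _ (by decide)
  -- transfer to `ℝ` along the injective `ℚ`-algebra map `ℝ → ℂ`
  let f : ℝ →ₐ[ℚ] ℂ := Complex.ofRealAm.restrictScalars ℚ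
  have hf : Function.Injective f := Complex.ofReal_injective
  have heq : f ∘ ![Real.exp 1, Real.pi] = ![(Real.pi : ℂ), (Real.exp 1 : ℂ)] ∘ ![(1 : Fin 2), 0] := by
    ext i
    fin_cases i <;> simp [f]
  show AlgebraicIndependent ℚ ![Real.exp 1, Real.pi]
  rw [← AlgHom.algebraicIndependent_iff f hf, heq]
  exact hswap

end EPiSimultaneousType.BoundedIndexCore

end Summit.Schanuel.Schanuel.Theorems

end
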